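import Summits.Ventures.CertifiedManyBodySolver.Downfold.EmeryFermiScaleHarmonic
import HarnessLib

/-!
# The sign of `β = fsT²·d|t′/t|/dε` over an energy RANGE, decided on rationals: bracket rules for the along-the-surface ordering of the one-band scale (§B.75 (c))

Venture CertifiedManyBodySolver, cell `pub/hubbard-downfold` (stage S1; INFLATION-RULES-3to1-B §B.75 (c)), seat hubbard-downfold-mod-4 (technique B, g30); namespace
`Summit.Ventures.CertifiedManyBodySolver.Downfold.Emery`. Sequel of `EmeryFermiScaleHarmonic` (`scaleBeta_eq`: `β = (t_pp + t_pp′)·core(ε)`, `core(ε) = t_pp′(t_pp − t_pp′)ε² + 4t_pd²t_pp′ε +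
t_pd²((t_pp + t_pp′)Δ − 2t_pd²)` non-decreasing in `ε ≥ 0`, `scaleBeta_core_mono`, `scaleBeta_nonpos_of`). Everything PROVED (0 sorry). WHAT THIS IS NOT: a statement about any material.

* `betaCoreQ` (the core on ℚ), `betaNonposCheck Δ a b c e` (`0 ≤ c ≤ b`, `core(e) ≤ 0`) ⇒ `scaleBeta ≤ 0` for every real `ε ∈ [0, e]` (`scaleBeta_nonpos_of_check`);
  `betaNonnegCheck Δ a b c e` (`0 ≤ c ≤ b`, `0 ≤ e`, `0 ≤ core(e)`) ⇒ `0 ≤ scaleBeta` for every real `ε ≥ e` (`scaleBeta_nonneg_of_check`). With `scaleT_mono_tpHarm` / `scaleT_anti_tpHarm`: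
  the sign decides, for every contour in the range, whether the velocity-matched `t` grows toward the large-harmonic (antinodal) side (`β ≤ 0`) or toward the small-harmonic side.

Sources: [HybertsenSchluterChristensen1989, Eq. (1)]; [AndersenEtAl1995, §6]; [folklore].
-/

noncomputable section

namespace Summit.Ventures.CertifiedManyBodySolver.Downfold.Emery

open Real Set

/-- The core bracket of `β` on rationals: `core(e) = c(b − c)e² + 4a²c·e + a²((b + c)Δ − 2a²)` at the σ point `(Δ, a, b, c) = (Δ_pd, t_pd, t_pp, t_pp′)`. [folklore] -/
def betaCoreQ (Δ a b c e : ℚ) : ℚ := c * (b - c) * e ^ 2 + 4 * a ^ 2 * c * e + a ^ 2 * ((b + c) * Δ - 2 * a ^ 2)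

/-- `betaNonposCheck`: `0 ≤ c ≤ b` and `core(e) ≤ 0`. [folklore] -/
def betaNonposCheck (Δ a b c e : ℚ) : Bool := decide (0 ≤ c) && decide (c ≤ b) && decide (betaCoreQ Δ a b c e ≤ 0)

/-- `betaNonnegCheck`: `0 ≤ c ≤ b`, `0 ≤ e` and `0 ≤ core(e)`. [folklore] -/
def betaNonnegCheck (Δ a b c e : ℚ) : Bool := decide (0 ≤ c) && decide (c ≤ b) && decide (0 ≤ e) && decide (0 ≤ betaCoreQ Δ a b c e)

/-- **SOUNDNESS (non-positive side)**: `betaNonposCheck Δ a b c e` ⇒ for every real `ε` with `0 ≤ ε ≤ e`, `scaleBeta Δ a b c ε ≤ 0` — hole doping raises the contour's `|t′/t|` throughout the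
range, so (by `scaleT_mono_tpHarm`) the large-harmonic side of every contour in the range carries the larger velocity-matched `t`. [folklore] -/
theorem scaleBeta_nonpos_of_check {Δ a b c e : ℚ} (h : betaNonposCheck Δ a b c e = true) {ε : ℝ} (h0 : 0 ≤ ε) (he : ε ≤ (e : ℝ)) :
    scaleBeta (Δ : ℝ) a b c ε ≤ 0 := by
  simp only [betaNonposCheck, Bool.and_eq_true, decide_eq_true_eq] at h
  obtain ⟨⟨hc, hcb⟩, hcore⟩ := h
  have hc' : (0 : ℝ) ≤ c := by exact_mod_cast hc
  have hcb' : (c : ℝ) ≤ b := by exact_mod_cast hcb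
  have htop : (c : ℝ) * (b - c) * (e : ℝ) ^ 2 + 4 * (a : ℝ) ^ 2 * c * e + (a : ℝ) ^ 2 * ((b + c) * Δ - 2 * (a : ℝ) ^ 2) ≤ 0 := by
    have : ((betaCoreQ Δ a b c e : ℚ) : ℝ) ≤ 0 := by exact_mod_cast hcore
    unfold betaCoreQ at this; push_cast at this; linarith
  have hmono := scaleBeta_core_mono (Δ := (Δ : ℝ)) (tpd := (a : ℝ)) (tpp := (b : ℝ)) (c := (c : ℝ)) hc' hcb' h0 he
  exact scaleBeta_nonpos_of (by linarith) (hmono.trans htop)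

/-- **SOUNDNESS (non-negative side)**: `betaNonnegCheck Δ a b c e` ⇒ for every real `ε ≥ e`, `0 ≤ scaleBeta Δ a b c ε` (the small-harmonic side carries the larger `t`, `scaleT_anti_tpHarm`).
[folklore] -/
theorem scaleBeta_nonneg_of_check {Δ a b c e : ℚ} (h : betaNonnegCheck Δ a b c e = true) {ε : ℝ} (he : (e : ℝ) ≤ ε) :
    0 ≤ scaleBeta (Δ : ℝ) a b c ε := by
  simp only [betaNonnegCheck, Bool.and_eq_true, decide_eq_true_eq] at h
  obtain ⟨⟨⟨hc, hcb⟩, he0⟩, hcore⟩ := h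
  have hc' : (0 : ℝ) ≤ c := by exact_mod_cast hc
  have hcb' : (c : ℝ) ≤ b := by exact_mod_cast hcb
  have he0' : (0 : ℝ) ≤ (e : ℝ) := by exact_mod_cast he0
  have hbot : 0 ≤ (c : ℝ) * (b - c) * (e : ℝ) ^ 2 + 4 * (a : ℝ) ^ 2 * c * e + (a : ℝ) ^ 2 * ((b + c) * Δ - 2 * (a : ℝ) ^ 2) := by
    have : 0 ≤ ((betaCoreQ Δ a b c e : ℚ) : ℝ) := by exact_mod_cast hcore
    unfold betaCoreQ at this; push_cast at this; linarith
  have hmono := scaleBeta_core_mono (Δ := (Δ : ℝ)) (tpd := (a : ℝ)) (tpp := (b : ℝ)) (c := (c : ℝ)) hc' hcb' he0' he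
  rw [scaleBeta_eq]
  exact mul_nonneg (by linarith) (hbot.trans hmono)

end Summit.Ventures.CertifiedManyBodySolver.Downfold.Emery
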